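import Summits.BirchSwinnertonDyer.BirchSwinnertonDyer.Theorems.GenusKolyvaginAtTwoPowDvdShaCardAtTwoRTStubCtOrthogonalAtTwo
import Summits.BirchSwinnertonDyer.BirchSwinnertonDyer.Theorems.GenusKolyvaginAtTwoPowDvdShaCardAtTwoPosTCrossPairProvenanceTransposition
import HarnessLib

/-!
# Route `GenusKolyvaginAtTwo`, crux L⁺_T `PowDvdShaCardAtTwoPosT` (stmt-BirchSwinnertonDyer-23379), road (E4)⁺ — STUB X-ORTH∃ SIGN-FREE, SECOND OF TWO FILES:
# the provenance socket and `ctOrthogonalAtTwo_of_frame_transposition` (twins of `…RTCrossPairProvenanceSocket` §3–§4 and of the X-ORTH∃ closer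
# `ctOrthogonalAtTwo_of_frame`; §1–§2 in `…PosTCrossPairProvenanceTransposition`)

Seat `bsd-line-gk2-p2` g22 (PROVER seat 2/3, cell `bsd-f1-sign2`), `--supports stmt-BirchSwinnertonDyer-23379` (helper; closes nothing).
THEOREMS ONLY (no definition, no named fact, no `sorry`).  BSD is NOT proved by any of this; neither is L⁺_T; (E4)⁺ still needs KS⁺ (the exact swap
engine with transposition primes) and the restated item L⁺_T′ (R9-L).

WHY (memo `Cruxes/KolyvaginExactAtTwoPosDiscT/RESTATEMENT-R9L-posdisc-lower-gk2p2.md`).  Road (E4) = capstone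
`pow_dvd_natCard_sha_of_kolyvaginSupplies_of_orthogonal_of_rank_le_one` (p741898, SIGN-FREE, prime predicates `Xp`/`Xm` free) fed by (R), KS and the
socket X-ORTH∃.  On `Δ < 0` X-ORTH∃ was closed by `ctOrthogonalAtTwo_of_frame` over gk2-p4's one-pair theorem and gk2-p5's provenance adapter, with
`Xp = Xm = FrobEqFrobInfty W K (2^L)` and `Δ < 0` entering ONLY through the regular frame at the cross places.  This file is the same chain with
the transposition frame (`…PosTTranspositionFrame`, `…PosTCrossTermTransposition`, this seat):
* §1 `ctLevelPairing_eq_zero_of_opposite_signs_of_level_eq_transposition` (one pair, `ι`-free, level free; cross places transposition-deep),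
* §2 `ctLevelPairing_eq_zero_of_kolyvaginClass_of_opposite_sign_transposition` (instantiated on a Kolyvagin class, ordered form),
* §3 `ctLevelPairing_eq_zero_of_kolyvagin_provenance_transposition` (both classes with provenance and recorded element signs),
* §4 `ctLevelPairing_hOrth_of_kolyvagin_provenance_transposition` (the capstone's `hOrth` literally, `Xp = Xm =` transposition clause),
* §5 **`ctOrthogonalAtTwo_of_frame_transposition`** — X-ORTH∃ of (E4)⁺: `∃ B` on `Ш(E_K)[2^k]` with the level-kernel clause and `hOrth` at class level
  `2^(2k)`, for EITHER sign of `Δ` (stub X-ORTH⁺ CLOSED as a theorem; it becomes a by-name stub closer once the LEAD registers an (E4)⁺ skeleton on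
  the restated L⁺_T′).
What (E4)⁺ still owes after this file: KS⁺ = `kolyvaginSuppliesAtTwo_of_…` with transposition primes (the exact swap engine: P7a⁼/P7b⁼ at a
regular place, the regular signed pair-Čebotarev = gk2-p4 g23 Parts A–C, T2, Q2), and (R⁺) on the cut (free: `…PosTOnCut.exists_frame_of_cut` ∘ B2Q⁺).

References: [McCallumLMS1991] §4 Lemma 4.3, Prop. 4.4, Prop. 4.7, §5 Lemma 5.3, Thm. 5.4; [GrossLMS1991] §3, Prop. 5.4, Prop. 6.2;
[MilneADT2006] I §6 Prop. 6.9, Lemma 6.17; [Cassels1962ArithmeticIV] §1; [Kolyvagin1991StructureSha]; [DokchitserDokchitserMathZ2012] Thm. (1).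
-/

set_option autoImplicit false

noncomputable section

open scoped Classical
open scoped AddSubgroup
open Function Field NumberField IsDedekindDomain WeierstrassCurve
open Literature.NumberTheory.EllipticCurves Literature.NumberTheory.GaloisRepresentations
open Literature.NumberTheory.EllipticCurves.ModularForms
open Literature.NumberTheory.GaloisCohomology
open Literature.NumberTheory.Automorphic
open Summit.BirchSwinnertonDyer.Rank1Residual.X11b.Relaxation
open Summit.BirchSwinnertonDyer.Rank1Residual.JET.GlobalDuality
open Summit.BirchSwinnertonDyer.Rank1Residual

-- the Theorems namespace of this sub repeats the summit name by design (D-0017 nested layout)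
set_option linter.dupNamespace false

namespace Summit.BirchSwinnertonDyer.BirchSwinnertonDyer.Theorems.GenusExact.PlusDescent

variable (W : WeierstrassCurve ℚ) (K : Type) [Field K] [NumberField K] [W.IsElliptic] [W.IsGloballyMinimal]

/-! ## §3 Provenance currency: both classes with recorded element signs -/

/-- **X-ORTH IN PROVENANCE CURRENCY, transposition-deep primes (sign-free twin of `ctLevelPairing_eq_zero_of_kolyvagin_provenance`).**  Both
classes `z = 2^{L−e₁}•c_L(n)`, `z′ = 2^{L−e₂}•c_L(n′)` with provenance at Zhang–Kolyvagin primes of index `≥ L` and TRANSPOSITION type, Selmer,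
own-vanishing, with RECORDED element signs `w(E)` / `−w(E)`; then `B_{2^k}(x, x′) = 0` (true-sign dichotomy + antisymmetry, as in the original).
(Proof adapted verbatim from gk2-p5 g27.) [cite: McCallumLMS1991, §4 Prop. 4.7, §5 Lemma 5.3, Thm. 5.4] [cite: GrossLMS1991, Prop. 5.4, Prop. 6.2 (1)]
[cite: Cassels1962ArithmeticIV, §1] [cite: MilneADT2006, Ch. I §6, Prop. 6.9] -/
theorem ctLevelPairing_eq_zero_of_kolyvagin_provenance_transposition [NeZero (W.conductorNorm ℤ)]
    (hK : IsImaginaryQuadratic K) (hodd' : Odd (NumberField.discr K)) (hne3 : NumberField.discr K ≠ -3)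
    (hH : SatisfiesHeegnerHypothesis (W.conductorNorm ℤ) K) (hodd : Odd W.tamagawaProduct)
    (hρ2 : W.HasSurjectiveModNGaloisRep 2) {τ : K ≃ₐ[ℚ] K} (hτ1 : τ ≠ 1)
    (Dt : ModularParametrizationData W (W.conductorNorm ℤ)) (β : ℤ) (ι : K →+* ℂ)
    {L k : ℕ} (hLk : L = 2 * k) (hk1 : 1 ≤ k) [NeZero (2 ^ k)] [NeZero (2 ^ k * 2 ^ k)]
    (e : (W.baseChange K).geomTorsion ((2 ^ k * 2 ^ k : ℕ) : ℤ) → (W.baseChange K).geomTorsion ((2 ^ k * 2 ^ k : ℕ) : ℤ) →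
      AlgebraicClosure K)
    (hμ : ∀ S T, e S T ^ (2 ^ k * 2 ^ k) = 1)
    (hadd₁ : ∀ S₁ S₂ T, e (S₁ + S₂) T = e S₁ T * e S₂ T)
    (hadd₂ : ∀ S T₁ T₂, e S (T₁ + T₂) = e S T₁ * e S T₂)
    (hgal : ∀ (γ : absoluteGaloisGroup K) (S T : (W.baseChange K).geomTorsion ((2 ^ k * 2 ^ k : ℕ) : ℤ)),
      γ • e S T = e (γ • S) (γ • T))
    (halt : ∀ T, e T T = 1)
    (hlift : ∀ (σ : K ≃ₐ[ℚ] K) (τ' : AlgebraicClosure K ≃+* AlgebraicClosure K) (hτ' : IsLiftOfAut σ τ')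
      (S T : (W.baseChange K).geomTorsion ((2 ^ k * 2 ^ k : ℕ) : ℤ)),
      τ' (e S T) = e (hτ'.torsionMap W ((2 ^ k * 2 ^ k : ℕ) : ℤ) S) (hτ'.torsionMap W ((2 ^ k * 2 ^ k : ℕ) : ℤ) T))
    (inv : LocalInvariants K (2 ^ k * 2 ^ k)) (hinvc : inv.IsConjCompatible τ) (hPT' : inv.SumInvLocalizationEqZero)
    (hH3 : ∀ c₃ : galoisCohomology (DiscreteGaloisModule.mu K (2 ^ k * 2 ^ k)) 3,
      (∀ v : Place K, galoisCohomology.localization (DiscreteGaloisModule.mu K (2 ^ k * 2 ^ k)) v 3 c₃ = 0) → c₃ = 0)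
    (hfin : ∀ D : GeneralCaseData (W.baseChange K) (2 ^ k) e hμ hadd₁ hadd₂ hgal,
      ∃ S : Finset (Place K), ∀ v ∉ S, D.localTerm inv v = 0)
    -- the (+)-class
    {n : ℕ} (hn : Squarefree n)
    (hKol : ∀ ℓ ∈ n.primeFactors, Zhang2014.IsKolyvaginPrime (W.conductorNorm ℤ) W K 2 ℓ ∧
      L ≤ Zhang2014.kolyvaginIndex W 2 ℓ ∧
        (∃ (v : HeightOneSpectrum (𝓞 ℚ)) (𝔓 : Ideal (absIntegers (𝓞 ℚ) ℚ)) (h : absoluteGaloisGroup ℚ),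
          (ℓ : 𝓞 ℚ) ∈ v.asIdeal ∧ 𝔓 ∈ v.primesAbove ∧ IsArithFrobAt (𝓞 ℚ) h 𝔓 ∧ ∃ u : geomTorsion W 2, h • u ≠ u))
    (d : KolyvaginHeegnerData Dt β ι n) {e₁ : ℕ} (he₁ : e₁ ≤ k)
    (hzS : ((2 ^ (L - e₁) : ℕ) : ℤ) • d.kolyvaginClass Nat.prime_two L ∈ selmerGroup (W.baseChange K) ((2 ^ L : ℕ) : ℤ))
    (hzloc : ∀ ℓ ∈ n.primeFactors, ∀ v : HeightOneSpectrum (𝓞 K), (ℓ : 𝓞 K) ∈ v.asIdeal →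
      ((2 ^ (L - e₁) : ℕ) : ℤ) • d.kolyvaginClass Nat.prime_two L ∈
        (W.baseChange K).torsionLocalKer (v.adicCompletion K) ((2 ^ L : ℕ) : ℤ))
    (hzsign : conjAct W τ ((2 ^ L : ℕ) : ℤ) (((2 ^ (L - e₁) : ℕ) : ℤ) • d.kolyvaginClass Nat.prime_two L) =
      W.rootNumber • (((2 ^ (L - e₁) : ℕ) : ℤ) • d.kolyvaginClass Nat.prime_two L))
    -- the (−)-class
    {n' : ℕ} (hn' : Squarefree n')
    (hKol' : ∀ ℓ ∈ n'.primeFactors, Zhang2014.IsKolyvaginPrime (W.conductorNorm ℤ) W K 2 ℓ ∧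
      L ≤ Zhang2014.kolyvaginIndex W 2 ℓ ∧
        (∃ (v : HeightOneSpectrum (𝓞 ℚ)) (𝔓 : Ideal (absIntegers (𝓞 ℚ) ℚ)) (h : absoluteGaloisGroup ℚ),
          (ℓ : 𝓞 ℚ) ∈ v.asIdeal ∧ 𝔓 ∈ v.primesAbove ∧ IsArithFrobAt (𝓞 ℚ) h 𝔓 ∧ ∃ u : geomTorsion W 2, h • u ≠ u))
    (d' : KolyvaginHeegnerData Dt β ι n') {e₂ : ℕ} (he₂ : e₂ ≤ k)
    (hz'S : ((2 ^ (L - e₂) : ℕ) : ℤ) • d'.kolyvaginClass Nat.prime_two L ∈ selmerGroup (W.baseChange K) ((2 ^ L : ℕ) : ℤ))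
    (hz'loc : ∀ ℓ ∈ n'.primeFactors, ∀ v : HeightOneSpectrum (𝓞 K), (ℓ : 𝓞 K) ∈ v.asIdeal →
      ((2 ^ (L - e₂) : ℕ) : ℤ) • d'.kolyvaginClass Nat.prime_two L ∈
        (W.baseChange K).torsionLocalKer (v.adicCompletion K) ((2 ^ L : ℕ) : ℤ))
    (hz'sign : conjAct W τ ((2 ^ L : ℕ) : ℤ) (((2 ^ (L - e₂) : ℕ) : ℤ) • d'.kolyvaginClass Nat.prime_two L) =
      (-W.rootNumber) • (((2 ^ (L - e₂) : ℕ) : ℤ) • d'.kolyvaginClass Nat.prime_two L))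
    -- the Ш-classes over them
    (x x' : ((W.baseChange K).sha)[((2 ^ k : ℕ) : ℤ)])
    (hx : shaTorsionVal (W.baseChange K) (2 ^ k) x =
      torsionH1ToH1 (W.baseChange K) ((2 ^ L : ℕ) : ℤ) (((2 ^ (L - e₁) : ℕ) : ℤ) • d.kolyvaginClass Nat.prime_two L))
    (hx' : shaTorsionVal (W.baseChange K) (2 ^ k) x' =
      torsionH1ToH1 (W.baseChange K) ((2 ^ L : ℕ) : ℤ) (((2 ^ (L - e₂) : ℕ) : ℤ) • d'.kolyvaginClass Nat.prime_two L)) :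
    ctLevelPairing (W.baseChange K) (2 ^ k) e hμ hadd₁ hadd₂ hgal inv halt hPT' hH3 hfin x x' = 0 := by
  have hne4 : NumberField.discr K ≠ -4 := fun h ↦ by
    rw [h] at hodd'
    exact (Int.not_even_iff_odd.mpr hodd') ⟨-2, by norm_num⟩
  have hsurj1 : W.HasSurjectiveModNGaloisRep ((2 : ℤ) ^ 1) := by rwa [pow_one]
  have hL1 : 1 ≤ L := by omega
  have hw : W.rootNumber = 1 ∨ W.rootNumber = -1 := W.rootNumber_eq_one_or
  have hKol₂ : ∀ ℓ ∈ n.primeFactors, Zhang2014.IsKolyvaginPrime (W.conductorNorm ℤ) W K 2 ℓ ∧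
      L ≤ Zhang2014.kolyvaginIndex W 2 ℓ := fun ℓ hℓ ↦ ⟨(hKol ℓ hℓ).1, (hKol ℓ hℓ).2.1⟩
  have hKol₂' : ∀ ℓ ∈ n'.primeFactors, Zhang2014.IsKolyvaginPrime (W.conductorNorm ℤ) W K 2 ℓ ∧
      L ≤ Zhang2014.kolyvaginIndex W 2 ℓ := fun ℓ hℓ ↦ ⟨(hKol' ℓ hℓ).1, (hKol' ℓ hℓ).2.1⟩
  -- the TRUE signs `ε_n`, `ε_{n′}` (Gross Prop. 5.4)
  have hε := KolyvaginClassSign.sign_conjAct_kolyvaginClass_two hK hne3 hne4 hodd' hH hsurj1 τ hτ1 Dt β ι hn hL1 hKol₂ d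
  have hε' := KolyvaginClassSign.sign_conjAct_kolyvaginClass_two hK hne3 hne4 hodd' hH hsurj1 τ hτ1 Dt β ι hn' hL1 hKol₂' d'
  have hzε : conjAct W τ ((2 ^ L : ℕ) : ℤ) (((2 ^ (L - e₁) : ℕ) : ℤ) • d.kolyvaginClass Nat.prime_two L) =
      (-W.rootNumber * (-1) ^ n.primeFactors.card) • (((2 ^ (L - e₁) : ℕ) : ℤ) • d.kolyvaginClass Nat.prime_two L) :=
    conjAct_two_pow_zsmul_kolyvaginClass_eq_sign_smul W K Dt β ι hK hne3 hne4 hodd' hH hsurj1 τ hτ1 hn hL1 hKol₂ d (L - e₁)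
  have hz'ε : conjAct W τ ((2 ^ L : ℕ) : ℤ) (((2 ^ (L - e₂) : ℕ) : ℤ) • d'.kolyvaginClass Nat.prime_two L) =
      (-W.rootNumber * (-1) ^ n'.primeFactors.card) • (((2 ^ (L - e₂) : ℕ) : ℤ) • d'.kolyvaginClass Nat.prime_two L) :=
    conjAct_two_pow_zsmul_kolyvaginClass_eq_sign_smul W K Dt β ι hK hne3 hne4 hodd' hH hsurj1 τ hτ1 hn' hL1 hKol₂' d' (L - e₂)
  -- the level kills the classes: `2^k • z = 0`, `2^k • z′ = 0`
  have hkz : ((2 ^ k : ℕ) : ℤ) • (((2 ^ (L - e₁) : ℕ) : ℤ) • d.kolyvaginClass Nat.prime_two L) = 0 :=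
    two_pow_smul_two_pow_sub_smul_eq_zero hLk he₁ (natCast_level_zsmul_galH1Torsion_eq_zero (W.baseChange K) _)
  have hkz' : ((2 ^ k : ℕ) : ℤ) • (((2 ^ (L - e₂) : ℕ) : ℤ) • d'.kolyvaginClass Nat.prime_two L) = 0 :=
    two_pow_smul_two_pow_sub_smul_eq_zero hLk he₂ (natCast_level_zsmul_galH1Torsion_eq_zero (W.baseChange K) _)
  -- dichotomy on the (+)-class: true sign `= w(E)`, or `2 z = 0`
  rcases eq_or_two_smul_eq_zero_of_smul_eq_of_smul_eq hw hε.1 hzsign hzε with hεw | h2z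
  · -- `ε_n = w(E)`: `z` first, `z′` is `(−ε_n)`-eigen by its recorded sign
    refine ctLevelPairing_eq_zero_of_kolyvaginClass_of_opposite_sign_transposition W K hK hodd' hne3 hH hodd hρ2 hτ1 Dt β ι hLk hk1 e hμ hadd₁
      hadd₂ hgal halt hlift inv hinvc hPT' hH3 hfin hn hKol d he₁ hzS hzloc hz'S hkz' hn' hKol₂' hz'loc ?_ x x' hx hx'
    rw [hεw]
    exact hz'sign.trans (neg_zsmul _ _)
  · -- `2 z = 0`: swap the pair; `z′` first, `z` is `(−ε_{n′})`-eigen because it is `2`-torsion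
    refine ctLevelPairing_eq_zero_of_swap_eq_zero (W.baseChange K) (2 ^ k) e hμ hadd₁ hadd₂ hgal inv halt hPT' hH3 hfin ?_
    refine ctLevelPairing_eq_zero_of_kolyvaginClass_of_opposite_sign_transposition W K hK hodd' hne3 hH hodd hρ2 hτ1 Dt β ι hLk hk1 e hμ hadd₁
      hadd₂ hgal halt hlift inv hinvc hPT' hH3 hfin hn' hKol' d' he₂ hz'S hz'loc hzS hkz hn hKol₂ hzloc ?_ x' x hx' hx
    have hnegε : -(-W.rootNumber * (-1) ^ n'.primeFactors.card) = 1 ∨ -(-W.rootNumber * (-1) ^ n'.primeFactors.card) = -1 := by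
      rcases hε'.1 with h | h <;> rw [h] <;> norm_num
    exact (smul_eq_of_smul_eq_of_two_smul_eq_zero hw hnegε hzsign h2z).trans (neg_zsmul _ _)

/-! ## §4 The capstone's socket `hOrth` with transposition predicates -/

/-- **THE SOCKET `hOrth` OF THE CAPSTONE FRAME with prime predicates `Xp = Xm =` «transposition type», DISCHARGED** (sign-free twin of
`ctLevelPairing_hOrth_of_kolyvagin_provenance`): for `B := ctLevelPairing (W.baseChange K) (2^k) e …`, all `x x′ ∈ Ш(E_K)[2^k]`, (+)-provenance of
`x` and (−)-provenance of `x′` at transposition-deep primes imply `B x x′ = 0` — the hypothesis `hOrth` of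
`pow_dvd_natCard_sha_of_kolyvaginSupplies_of_orthogonal_of_rank_le_one` (p741898) with `Xp ℓ = Xm ℓ =` the transposition clause.  NO sign of `Δ`.
(Proof adapted verbatim from gk2-p5 g27.) [cite: McCallumLMS1991, §4 Prop. 4.7, §5 Lemma 5.3, Thm. 5.4] [cite: GrossLMS1991, Prop. 5.4, Prop. 6.2]
[cite: Cassels1962ArithmeticIV, §1] [cite: MilneADT2006, Ch. I §6, Prop. 6.9] -/
theorem ctLevelPairing_hOrth_of_kolyvagin_provenance_transposition [NeZero (W.conductorNorm ℤ)]
    (hK : IsImaginaryQuadratic K) (hodd' : Odd (NumberField.discr K)) (hne3 : NumberField.discr K ≠ -3)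
    (hH : SatisfiesHeegnerHypothesis (W.conductorNorm ℤ) K) (hodd : Odd W.tamagawaProduct)
    (hρ2 : W.HasSurjectiveModNGaloisRep 2) (τ : K ≃ₐ[ℚ] K) (hτ1 : τ ≠ 1)
    (Dt : ModularParametrizationData W (W.conductorNorm ℤ)) (β : ℤ) (ι : K →+* ℂ)
    (L k : ℕ) (hLk : L = 2 * k) (hk1 : 1 ≤ k) [NeZero (2 ^ k)] [NeZero (2 ^ k * 2 ^ k)]
    (e : (W.baseChange K).geomTorsion ((2 ^ k * 2 ^ k : ℕ) : ℤ) → (W.baseChange K).geomTorsion ((2 ^ k * 2 ^ k : ℕ) : ℤ) →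
      AlgebraicClosure K)
    (hμ : ∀ S T, e S T ^ (2 ^ k * 2 ^ k) = 1)
    (hadd₁ : ∀ S₁ S₂ T, e (S₁ + S₂) T = e S₁ T * e S₂ T)
    (hadd₂ : ∀ S T₁ T₂, e S (T₁ + T₂) = e S T₁ * e S T₂)
    (hgal : ∀ (γ : absoluteGaloisGroup K) (S T : (W.baseChange K).geomTorsion ((2 ^ k * 2 ^ k : ℕ) : ℤ)),
      γ • e S T = e (γ • S) (γ • T))
    (halt : ∀ T, e T T = 1)
    (hlift : ∀ (σ : K ≃ₐ[ℚ] K) (τ' : AlgebraicClosure K ≃+* AlgebraicClosure K) (hτ' : IsLiftOfAut σ τ')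
      (S T : (W.baseChange K).geomTorsion ((2 ^ k * 2 ^ k : ℕ) : ℤ)),
      τ' (e S T) = e (hτ'.torsionMap W ((2 ^ k * 2 ^ k : ℕ) : ℤ) S) (hτ'.torsionMap W ((2 ^ k * 2 ^ k : ℕ) : ℤ) T))
    (inv : LocalInvariants K (2 ^ k * 2 ^ k)) (hinvc : inv.IsConjCompatible τ) (hPT' : inv.SumInvLocalizationEqZero)
    (hH3 : ∀ c₃ : galoisCohomology (DiscreteGaloisModule.mu K (2 ^ k * 2 ^ k)) 3,
      (∀ v : Place K, galoisCohomology.localization (DiscreteGaloisModule.mu K (2 ^ k * 2 ^ k)) v 3 c₃ = 0) → c₃ = 0)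
    (hfin : ∀ D : GeneralCaseData (W.baseChange K) (2 ^ k) e hμ hadd₁ hadd₂ hgal,
      ∃ S : Finset (Place K), ∀ v ∉ S, D.localTerm inv v = 0) :
    ∀ x x' : ↥((↥(W.baseChange K).sha)[((2 ^ k : ℕ) : ℤ)]),
      (∃ (n : ℕ) (d : KolyvaginHeegnerData Dt β ι n) (e : ℕ), Squarefree n ∧
        (∀ ℓ ∈ n.primeFactors, Zhang2014.IsKolyvaginPrime (W.conductorNorm ℤ) W K 2 ℓ ∧ L ≤ Zhang2014.kolyvaginIndex W 2 ℓ ∧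
        (∃ (v : HeightOneSpectrum (𝓞 ℚ)) (𝔓 : Ideal (absIntegers (𝓞 ℚ) ℚ)) (h : absoluteGaloisGroup ℚ),
          (ℓ : 𝓞 ℚ) ∈ v.asIdeal ∧ 𝔓 ∈ v.primesAbove ∧ IsArithFrobAt (𝓞 ℚ) h 𝔓 ∧ ∃ u : geomTorsion W 2, h • u ≠ u)) ∧
        e ≤ k ∧
        ((2 ^ (L - e) : ℕ) : ℤ) • d.kolyvaginClass Nat.prime_two L ∈ selmerGroup (W.baseChange K) ((2 ^ L : ℕ) : ℤ) ∧
        (∀ ℓ ∈ n.primeFactors, ∀ v : HeightOneSpectrum (𝓞 K), ((ℓ : ℕ) : 𝓞 K) ∈ v.asIdeal →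
          ((2 ^ (L - e) : ℕ) : ℤ) • d.kolyvaginClass Nat.prime_two L ∈
            (W.baseChange K).torsionLocalKer (v.adicCompletion K) ((2 ^ L : ℕ) : ℤ)) ∧
        conjAct W τ ((2 ^ L : ℕ) : ℤ) (((2 ^ (L - e) : ℕ) : ℤ) • d.kolyvaginClass Nat.prime_two L) =
          W.rootNumber • (((2 ^ (L - e) : ℕ) : ℤ) • d.kolyvaginClass Nat.prime_two L) ∧
        ((x : (W.baseChange K).sha) : (W.baseChange K).galH1) =
          torsionH1ToH1 (W.baseChange K) ((2 ^ L : ℕ) : ℤ) (((2 ^ (L - e) : ℕ) : ℤ) • d.kolyvaginClass Nat.prime_two L)) →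
      (∃ (n : ℕ) (d : KolyvaginHeegnerData Dt β ι n) (e : ℕ), Squarefree n ∧
        (∀ ℓ ∈ n.primeFactors, Zhang2014.IsKolyvaginPrime (W.conductorNorm ℤ) W K 2 ℓ ∧ L ≤ Zhang2014.kolyvaginIndex W 2 ℓ ∧
        (∃ (v : HeightOneSpectrum (𝓞 ℚ)) (𝔓 : Ideal (absIntegers (𝓞 ℚ) ℚ)) (h : absoluteGaloisGroup ℚ),
          (ℓ : 𝓞 ℚ) ∈ v.asIdeal ∧ 𝔓 ∈ v.primesAbove ∧ IsArithFrobAt (𝓞 ℚ) h 𝔓 ∧ ∃ u : geomTorsion W 2, h • u ≠ u)) ∧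
        e ≤ k ∧
        ((2 ^ (L - e) : ℕ) : ℤ) • d.kolyvaginClass Nat.prime_two L ∈ selmerGroup (W.baseChange K) ((2 ^ L : ℕ) : ℤ) ∧
        (∀ ℓ ∈ n.primeFactors, ∀ v : HeightOneSpectrum (𝓞 K), ((ℓ : ℕ) : 𝓞 K) ∈ v.asIdeal →
          ((2 ^ (L - e) : ℕ) : ℤ) • d.kolyvaginClass Nat.prime_two L ∈
            (W.baseChange K).torsionLocalKer (v.adicCompletion K) ((2 ^ L : ℕ) : ℤ)) ∧
        conjAct W τ ((2 ^ L : ℕ) : ℤ) (((2 ^ (L - e) : ℕ) : ℤ) • d.kolyvaginClass Nat.prime_two L) =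
          (-W.rootNumber) • (((2 ^ (L - e) : ℕ) : ℤ) • d.kolyvaginClass Nat.prime_two L) ∧
        ((x' : (W.baseChange K).sha) : (W.baseChange K).galH1) =
          torsionH1ToH1 (W.baseChange K) ((2 ^ L : ℕ) : ℤ) (((2 ^ (L - e) : ℕ) : ℤ) • d.kolyvaginClass Nat.prime_two L)) →
      ctLevelPairing (W.baseChange K) (2 ^ k) e hμ hadd₁ hadd₂ hgal inv halt hPT' hH3 hfin x x' = 0 := by
  rintro x x' ⟨n, d, e₁, hn, hKol, he₁, hzS, hzloc, hzsign, hx⟩ ⟨n', d', e₂, hn', hKol', he₂, hz'S, hz'loc, hz'sign, hx'⟩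
  exact ctLevelPairing_eq_zero_of_kolyvagin_provenance_transposition W K hK hodd' hne3 hH hodd hρ2 hτ1 Dt β ι hLk hk1 e hμ hadd₁ hadd₂ hgal
    halt hlift inv hinvc hPT' hH3 hfin hn hKol d he₁ hzS hzloc hzsign hn' hKol' d' he₂ hz'S hz'loc hz'sign x x' hx hx'

end Summit.BirchSwinnertonDyer.BirchSwinnertonDyer.Theorems.GenusExact.PlusDescent

/-! ## §5 X-ORTH∃ of (E4)⁺, sign-free -/

namespace Summit.BirchSwinnertonDyer.BirchSwinnertonDyer.Theorems.GenusExact.PlusDescent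

open Summit.BirchSwinnertonDyer.BirchSwinnertonDyer.Theses.GenusKolyvaginAtTwo

/-- **X-ORTH∃ OF ROAD (E4)⁺, SIGN-FREE** (twin of `ctOrthogonalAtTwo_of_frame`, the X-ORTH∃ stub closer of L_T's road (E4), gk2-p5 g27 / gk2-p4
g21): for `τ ≠ 1` and `k ≥ 1`, the level-`2^k` Cassels–Tate pairing `B` of the canonical invariant maps on `Ш(E_K)[2^k]` satisfies the level clause and
kills (+)-provenance × (−)-provenance Kolyvagin classes at class level `2^(2k)` whose primes are Zhang–Kolyvagin of index `≥ 2k` and of TRANSPOSITION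
type (Frobenius moves a point of `E[2]`).  Habitat: `W/ℚ` globally minimal with odd Tamagawa product and `ρ_{E,2^n}` onto for all `n ≥ 1` — ANY sign of
`Δ`; `K` imaginary quadratic, `d_K` odd `≠ −3`, Heegner.  This is the stub X-ORTH∃ of (E4)⁺ for L⁺_T (`Δ > 0`), and on `Δ < 0` it implies the landed
X-ORTH∃ (`transposition_of_frobEqFrobInfty_of_Δ_neg`). (Proof adapted verbatim from `ctOrthogonalAtTwo_of_frame`.)
[cite: McCallumLMS1991, §4 Prop. 4.7, §5 Lemma 5.3] [cite: MilneADT2006, Ch. I §6 Prop. 6.9, Lemma 6.17] [cite: Cassels1962ArithmeticIV, §1]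
[cite: GrossLMS1991, Prop. 5.4, Prop. 6.2] -/
theorem ctOrthogonalAtTwo_of_frame_transposition (W : WeierstrassCurve ℚ) [W.IsElliptic] [W.IsGloballyMinimal] [NeZero (W.conductorNorm ℤ)]
    (hT : Odd W.tamagawaProduct) (K : Type) [Field K] [NumberField K] (hIQ : IsImaginaryQuadratic K)
    (hodd : Odd (NumberField.discr K)) (h3 : NumberField.discr K ≠ -3) (hHe : SatisfiesHeegnerHypothesis (W.conductorNorm ℤ) K)
    (hρ : ∀ n : ℕ, 0 < n → W.HasSurjectiveModNGaloisRep ((2 : ℤ) ^ n))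
    (Dt : ModularParametrizationData W (W.conductorNorm ℤ)) (β : ℤ) (ι : K →+* ℂ) (τ : K ≃ₐ[ℚ] K) (hτ : τ ≠ 1) (k : ℕ) (hk1 : 1 ≤ k) :
    ∃ B : ↥((↥(W.baseChange K).sha)[((2 ^ k : ℕ) : ℤ)]) →+ ↥((↥(W.baseChange K).sha)[((2 ^ k : ℕ) : ℤ)]) →+ AddCircle (1 : ℚ),
      (∀ x : ↥((↥(W.baseChange K).sha)[((2 ^ k : ℕ) : ℤ)]), B x = 0 →
        ∃ z : (W.baseChange K).sha, (2 ^ k) • z = (x : (W.baseChange K).sha)) ∧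
      (∀ x x' : ↥((↥(W.baseChange K).sha)[((2 ^ k : ℕ) : ℤ)]),
      (∃ (n : ℕ) (d : KolyvaginHeegnerData Dt β ι n) (e : ℕ), Squarefree n ∧
        (∀ ℓ ∈ n.primeFactors, Zhang2014.IsKolyvaginPrime (W.conductorNorm ℤ) W K 2 ℓ ∧ 2 * k ≤ Zhang2014.kolyvaginIndex W 2 ℓ ∧
        (∃ (v : HeightOneSpectrum (𝓞 ℚ)) (𝔓 : Ideal (absIntegers (𝓞 ℚ) ℚ)) (h : absoluteGaloisGroup ℚ),
          (ℓ : 𝓞 ℚ) ∈ v.asIdeal ∧ 𝔓 ∈ v.primesAbove ∧ IsArithFrobAt (𝓞 ℚ) h 𝔓 ∧ ∃ u : geomTorsion W 2, h • u ≠ u)) ∧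
        e ≤ k ∧
        ((2 ^ (2 * k - e) : ℕ) : ℤ) • d.kolyvaginClass Nat.prime_two (2 * k) ∈ selmerGroup (W.baseChange K) ((2 ^ (2 * k) : ℕ) : ℤ) ∧
        (∀ ℓ ∈ n.primeFactors, ∀ u : HeightOneSpectrum (𝓞 K), ((ℓ : ℕ) : 𝓞 K) ∈ u.asIdeal →
          ((2 ^ (2 * k - e) : ℕ) : ℤ) • d.kolyvaginClass Nat.prime_two (2 * k) ∈
            (W.baseChange K).torsionLocalKer (u.adicCompletion K) ((2 ^ (2 * k) : ℕ) : ℤ)) ∧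
        conjAct W τ ((2 ^ (2 * k) : ℕ) : ℤ) (((2 ^ (2 * k - e) : ℕ) : ℤ) • d.kolyvaginClass Nat.prime_two (2 * k)) =
          W.rootNumber • (((2 ^ (2 * k - e) : ℕ) : ℤ) • d.kolyvaginClass Nat.prime_two (2 * k)) ∧
        ((x : (W.baseChange K).sha) : (W.baseChange K).galH1) =
          torsionH1ToH1 (W.baseChange K) ((2 ^ (2 * k) : ℕ) : ℤ) (((2 ^ (2 * k - e) : ℕ) : ℤ) • d.kolyvaginClass Nat.prime_two (2 * k))) →
      (∃ (n : ℕ) (d : KolyvaginHeegnerData Dt β ι n) (e : ℕ), Squarefree n ∧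
        (∀ ℓ ∈ n.primeFactors, Zhang2014.IsKolyvaginPrime (W.conductorNorm ℤ) W K 2 ℓ ∧ 2 * k ≤ Zhang2014.kolyvaginIndex W 2 ℓ ∧
        (∃ (v : HeightOneSpectrum (𝓞 ℚ)) (𝔓 : Ideal (absIntegers (𝓞 ℚ) ℚ)) (h : absoluteGaloisGroup ℚ),
          (ℓ : 𝓞 ℚ) ∈ v.asIdeal ∧ 𝔓 ∈ v.primesAbove ∧ IsArithFrobAt (𝓞 ℚ) h 𝔓 ∧ ∃ u : geomTorsion W 2, h • u ≠ u)) ∧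
        e ≤ k ∧
        ((2 ^ (2 * k - e) : ℕ) : ℤ) • d.kolyvaginClass Nat.prime_two (2 * k) ∈ selmerGroup (W.baseChange K) ((2 ^ (2 * k) : ℕ) : ℤ) ∧
        (∀ ℓ ∈ n.primeFactors, ∀ u : HeightOneSpectrum (𝓞 K), ((ℓ : ℕ) : 𝓞 K) ∈ u.asIdeal →
          ((2 ^ (2 * k - e) : ℕ) : ℤ) • d.kolyvaginClass Nat.prime_two (2 * k) ∈
            (W.baseChange K).torsionLocalKer (u.adicCompletion K) ((2 ^ (2 * k) : ℕ) : ℤ)) ∧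
        conjAct W τ ((2 ^ (2 * k) : ℕ) : ℤ) (((2 ^ (2 * k - e) : ℕ) : ℤ) • d.kolyvaginClass Nat.prime_two (2 * k)) =
          (-W.rootNumber) • (((2 ^ (2 * k - e) : ℕ) : ℤ) • d.kolyvaginClass Nat.prime_two (2 * k)) ∧
        ((x' : (W.baseChange K).sha) : (W.baseChange K).galH1) =
          torsionH1ToH1 (W.baseChange K) ((2 ^ (2 * k) : ℕ) : ℤ) (((2 ^ (2 * k - e) : ℕ) : ℤ) • d.kolyvaginClass Nat.prime_two (2 * k))) →
      B x x' = 0) := by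
  haveI : Fact (Nat.Prime 2) := ⟨Nat.prime_two⟩
  haveI : IsTotallyComplex K := hIQ.2
  haveI hell : (W.baseChange K).IsElliptic := inferInstanceAs ((W.map (algebraMap ℚ K)).IsElliptic)
  haveI : NeZero (2 ^ k) := ⟨pow_ne_zero _ two_ne_zero⟩
  haveI : NeZero (2 ^ k * 2 ^ k) := ⟨mul_ne_zero (pow_ne_zero _ two_ne_zero) (pow_ne_zero _ two_ne_zero)⟩
  have hρ2 : W.HasSurjectiveModNGaloisRep 2 := by simpa using hρ 1 one_pos
  have h2N : 2 ≤ 2 ^ k * 2 ^ k := by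
    have h2 : 2 ≤ 2 ^ k := by
      calc (2 : ℕ) = 2 ^ 1 := by norm_num
        _ ≤ 2 ^ k := Nat.pow_le_pow_right (by norm_num) hk1
    nlinarith
  -- the Weil datum, equivariant under every lift of every `σ ∈ Aut(K/ℚ)`
  obtain ⟨e, hμ, hadd₁, hadd₂, halt, hnd, hgal, hlift⟩ := exists_weilPairing_liftEquivariant W K (2 ^ k * 2 ^ k) h2N
  -- the canonical invariant maps and the level pairing
  have hB := CasselsTateTotallyComplex.isLevelPairing_ctLevelPairing_canonical (W.baseChange K) 2 k e hμ hadd₁ hadd₂ hgal halt hnd hk1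
  refine ⟨ctLevelPairing (W.baseChange K) (2 ^ k) e hμ hadd₁ hadd₂ hgal (LocalInvariants.canonical K (2 ^ k * 2 ^ k)) halt
      (sumInvLocalizationEqZero_canonical_of_numberField K (2 ^ k * 2 ^ k))
      (CasselsTatePTc.shaThree_mu_eq_zero_of_isTotallyComplex (K := K) (2 ^ k * 2 ^ k))
      (localTerm_finite_support (W.baseChange K) (2 ^ k) e hμ hadd₁ hadd₂ hgal halt (LocalInvariants.canonical K (2 ^ k * 2 ^ k))),
    fun x hx ↦ (hB.2 x).mp fun y ↦ ?_, ?_⟩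
  · rw [hx, AddMonoidHom.zero_apply]
  · exact ctLevelPairing_hOrth_of_kolyvagin_provenance_transposition W K hIQ hodd h3 hHe hT hρ2 τ hτ Dt β ι (2 * k) k rfl hk1 e hμ hadd₁ hadd₂
      hgal halt hlift (LocalInvariants.canonical K (2 ^ k * 2 ^ k)) (isConjCompatible_canonical τ (2 ^ k * 2 ^ k))
      (sumInvLocalizationEqZero_canonical_of_numberField K (2 ^ k * 2 ^ k))
      (CasselsTatePTc.shaThree_mu_eq_zero_of_isTotallyComplex (K := K) (2 ^ k * 2 ^ k))
      (localTerm_finite_support (W.baseChange K) (2 ^ k) e hμ hadd₁ hadd₂ hgal halt (LocalInvariants.canonical K (2 ^ k * 2 ^ k)))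

end Summit.BirchSwinnertonDyer.BirchSwinnertonDyer.Theorems.GenusExact.PlusDescent

end
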